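import Literature.Probability.Percolation.OneArmHittingPDEAnalytic
import Literature.Probability.Percolation.OneArmScalingLimitProofs
import HarnessLib

/-!
# The one-arm exponent and LSW Theorem 1.2 from the trace identification alone (proofs only)

Topic `Literature/Probability/Percolation`; family `crit-perc`. Def-free glue between the two
halves of the discharge of the named fact
`Literature.Probability.Percolation.LawlerSchrammWerner2002_hittingPDE` (`OneArmHittingPDE.lean`;
Lawler–Schramm–Werner, *One-arm exponent for critical 2D percolation*, Electron. J. Probab. **7**
(2002), paper no. 2, §2) and its two consumers, LSW **Theorem 1.2**
(`LawlerSchrammWerner2002_scalingLimitExponent`, `OneArmScalingLimit.lean`) and LSW **Theorem 1.1**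
(`oneArm_exponent`, `ArmExponents.lean`):

* the ANALYTIC half is a theorem of this library: `isHittingPDEData_lswHit`
  (`OneArmHittingPDEAnalytic.lean`) — the semigroup solution `u = lswHit 6` (`u(θ, t) = P_t 1(θ)`
  of the diffusion (2.11) killed at `θ = 0`, reflected at `θ = 2π`; the series
  `Σ γ_n e^{-λ_n t} φ_n`) has every property LSW's Lemma 2.2, (2.3) and Lemma 2.3 assert of the
  hitting function `h(θ, t) = P[𝔯(θ) ≤ e^{-t}]` of (2.2): monotone, `[0,1]`-valued, positive,
  `C^{2,1}` with the PDE (2.4) `(κ/2) ∂_θ² h + cot(θ/2) ∂_θ h - ∂_t h = 0` (`κ = 6`), the Dirichlet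
  behaviour (2.3) at `θ = 0` and the Neumann condition (2.12) of the window average at `θ = 2π`;
* the PROBABILISTIC half is the *trace identification*: for the weak limit `ν` of the laws
  `lswLaw R` of `Q_{1/R}` (or for every subsequential weak limit along `R_k → ∞`) and every
  `t > 0`, `u(2π, t) = ν{K | 𝔯(K) ≤ e^{-t}}` — (2.2) at `θ = 2π` read through Smirnov's
  Theorem 2.1 (the `SLE₆` description of `Q(θ)`), the radial Loewner equation (2.5)–(2.9), the
  strong Markov property (2.10) and Lemma 2.3; it needs the convergence of the percolation
  exploration process to `SLE₆`, which neither Mathlib nor this library has, and is therefore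
  kept as an explicit HYPOTHESIS of the theorems below (never a named fact: it is the remaining
  proof obligation of `LawlerSchrammWerner2002_hittingPDE` itself, cf. the D-0026 review recorded
  in `OneArmSubsequentialLimits.lean`).

Feeding `isHittingPDEData_lswHit` to the subsequential-limit pipeline
(`oneArm_exponent_of_subseqHittingPDE`, `OneArmSubsequentialLimits.lean`;
`LawlerSchrammWerner2002_hittingPDE_of_subseqHittingPDE` and
`LawlerSchrammWerner2002_scalingLimitExponent_of_subseqHittingPDE`, `OneArmScalingLimitProofs.lean`)
gives:

* `oneArm_exponent_of_subseqTrace` — the one-arm exponent `5/48` (LSW Thm. 1.1) from the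
  subsequential trace identification ALONE (no existence of the full scaling limit, no further
  analytic input);
* `LawlerSchrammWerner2002_hittingPDE_of_subseqTrace`,
  `LawlerSchrammWerner2002_scalingLimitExponent_of_subseqTrace` — the named fact and LSW Thm. 1.2
  from the same hypothesis;
* `LawlerSchrammWerner2002_scalingLimitExponent_of_trace`,
  `oneArm_exponent_of_scalingLimit_of_trace` — the versions at the full weak limit (the
  hypothesis of `LawlerSchrammWerner2002_hittingPDE_of_trace`).

So the discharges `LawlerSchrammWerner2002_hittingPDE_holds` and
`LawlerSchrammWerner2002_scalingLimitExponent_holds` are now EXACTLY the trace identification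
away. The case `t ≤ 0` of the identification is automatic
(`lswHit_two_pi_eq_measureReal_of_nonpos`: `u = 1` there and `𝔯 ≤ 1 ≤ e^{-t}` by Schwarz), which
is why the hypotheses below ask for `t > 0` only. No definitions and no named facts are
introduced. This file is kept separate from `OneArmScalingLimitProofs.lean` so that the latter's
importers (`OneArmScalingLimitAvoidance.lean`, `OneArmScalingLimitConnection.lean`) do not acquire
the Jacobi-heat-series closure of `OneArmHittingPDEAnalytic.lean`.

## References

* G. F. Lawler, O. Schramm, W. Werner, *One-arm exponent for critical 2D percolation*, Electron.
  J. Probab. **7** (2002), no. 2: Thm. 1.1, Thm. 1.2 (p. 2); §2: Thm. 2.1 (p. 3), (2.1)–(2.4),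
  Lemma 2.2 (p. 4), (2.10)–(2.12), Lemma 2.3 (p. 6), proof of Thm. 1.2 (pp. 7–8); §3.
  [LawlerSchrammWernerEJP2002]
-/

noncomputable section

open Filter MeasureTheory TopologicalSpace
open scoped Topology

namespace Literature.Probability.Percolation

/-- **The trace identification for all `t` from the identification for `t > 0`.** For a
probability measure `ν` on non-empty compacts of `ℂ`, if `u(2π, t) = ν{K | 𝔯(K) ≤ e^{-t}}` for all
`t > 0` (`u = lswHit 6`), then it holds for all real `t`: for `t ≤ 0` both sides equal `1`
(`lswHit_two_pi_eq_measureReal_of_nonpos`; `𝔯 ≤ 1` by Schwarz's lemma).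
[cite: LawlerSchrammWernerEJP2002, §2 (2.2) (p. 4)] -/
theorem lswHit_two_pi_eq_measureReal_of_forall_pos (ν : ProbabilityMeasure (NonemptyCompacts ℂ))
    (hpos : ∀ t : ℝ, 0 < t → lswHit 6 (2 * Real.pi) t = (ν : Measure (NonemptyCompacts ℂ)).real
      {K | Literature.Analysis.Complex.conformalRadius (K : Set ℂ) ≤ Real.exp (-t)}) (t : ℝ) :
    lswHit 6 (2 * Real.pi) t = (ν : Measure (NonemptyCompacts ℂ)).real
      {K | Literature.Analysis.Complex.conformalRadius (K : Set ℂ) ≤ Real.exp (-t)} := by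
  rcases le_or_gt t 0 with ht | ht
  · exact lswHit_two_pi_eq_measureReal_of_nonpos ν ht
  · exact hpos t ht

/-- **LSW Theorem 1.1 (the one-arm exponent `5/48`) from the subsequential trace
identification alone.** If for every weak limit `ν` of the laws `lswLaw R` of `Q_{1/R}` along a
sequence `R_k → ∞` and every `t > 0` the distribution function of the conformal radius is the
trace of the semigroup solution, `u(2π, t) = ν{K | 𝔯(K) ≤ e^{-t}}` ((2.2) at `θ = 2π` through
Thm. 2.1, (2.5)–(2.10) and Lemma 2.3 — the `SLE₆` input), then `oneArm_exponent` holds: the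
analytic half `isHittingPDEData_lswHit` (Lemma 2.2, (2.3), (2.12) for `u`) is a theorem, and
`oneArm_exponent_of_subseqHittingPDE` (maximum principle (2.17), Koebe, (2.1), portmanteau, §3)
concludes. The existence of the full scaling limit is not used.
[cite: LawlerSchrammWernerEJP2002, Thm. 1.1 (p. 2), §2–§3] -/
theorem oneArm_exponent_of_subseqTrace
    (htr : ∀ (R : ℕ → ℝ) (ν : ProbabilityMeasure (NonemptyCompacts ℂ)),
      Tendsto R atTop atTop → Tendsto (lswLaw ∘ R) atTop (𝓝 ν) →
        ∀ t : ℝ, 0 < t → lswHit 6 (2 * Real.pi) t = (ν : Measure (NonemptyCompacts ℂ)).real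
          {K | Literature.Analysis.Complex.conformalRadius (K : Set ℂ) ≤ Real.exp (-t)}) :
    oneArm_exponent :=
  oneArm_exponent_of_subseqHittingPDE isHittingPDEData_lswHit
    fun R ν hR hν => lswHit_two_pi_eq_measureReal_of_forall_pos ν (htr R ν hR hν)

/-- **`LawlerSchrammWerner2002_hittingPDE` from the subsequential trace identification**: with
`h = lswHit 6` and its derivative fields; a weak limit along the reals is a weak limit along
`R_k = k` (`LawlerSchrammWerner2002_hittingPDE_of_subseqHittingPDE`).
[cite: LawlerSchrammWernerEJP2002, §2: (2.2)–(2.4), Lemma 2.2 (p. 4), (2.3), Lemma 2.3 (p. 6)] -/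
theorem LawlerSchrammWerner2002_hittingPDE_of_subseqTrace
    (htr : ∀ (R : ℕ → ℝ) (ν : ProbabilityMeasure (NonemptyCompacts ℂ)),
      Tendsto R atTop atTop → Tendsto (lswLaw ∘ R) atTop (𝓝 ν) →
        ∀ t : ℝ, 0 < t → lswHit 6 (2 * Real.pi) t = (ν : Measure (NonemptyCompacts ℂ)).real
          {K | Literature.Analysis.Complex.conformalRadius (K : Set ℂ) ≤ Real.exp (-t)}) :
    LawlerSchrammWerner2002_hittingPDE :=
  LawlerSchrammWerner2002_hittingPDE_of_subseqHittingPDE isHittingPDEData_lswHit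
    fun R ν hR hν => lswHit_two_pi_eq_measureReal_of_forall_pos ν (htr R ν hR hν)

/-- **LSW Theorem 1.2 from the subsequential trace identification**: under the same hypothesis,
`LawlerSchrammWerner2002_scalingLimitExponent` holds — for every weak limit `ν` of `lswLaw`,
`c⁻¹ r^{5/48} ≤ ν{dist(0, K) < r} ≤ c r^{5/48}` for `r ∈ (0, 1/2)`
(`LawlerSchrammWerner2002_scalingLimitExponent_of_subseqHittingPDE`).
[cite: LawlerSchrammWernerEJP2002, Thm. 1.2 (p. 2) and its proof (pp. 3–8)] -/
theorem LawlerSchrammWerner2002_scalingLimitExponent_of_subseqTrace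
    (htr : ∀ (R : ℕ → ℝ) (ν : ProbabilityMeasure (NonemptyCompacts ℂ)),
      Tendsto R atTop atTop → Tendsto (lswLaw ∘ R) atTop (𝓝 ν) →
        ∀ t : ℝ, 0 < t → lswHit 6 (2 * Real.pi) t = (ν : Measure (NonemptyCompacts ℂ)).real
          {K | Literature.Analysis.Complex.conformalRadius (K : Set ℂ) ≤ Real.exp (-t)}) :
    LawlerSchrammWerner2002_scalingLimitExponent :=
  LawlerSchrammWerner2002_scalingLimitExponent_of_subseqHittingPDE isHittingPDEData_lswHit
    fun R ν hR hν => lswHit_two_pi_eq_measureReal_of_forall_pos ν (htr R ν hR hν)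

/-- **LSW Theorem 1.2 from the trace identification at the weak limit**: if for every weak limit
`ν` of `lswLaw` (along the reals) and every `t > 0`, `u(2π, t) = ν{K | 𝔯(K) ≤ e^{-t}}` (the
hypothesis of `LawlerSchrammWerner2002_hittingPDE_of_trace`), then
`LawlerSchrammWerner2002_scalingLimitExponent` holds
(`LawlerSchrammWerner2002_scalingLimitExponent_of_hittingPDE`). This is the printed route:
Thm. 2.1 + Lemma 2.2 + (2.3) + Lemma 2.3, then (2.17) and (2.1).
[cite: LawlerSchrammWernerEJP2002, Thm. 1.2 (p. 2) and its proof (pp. 3–8)] -/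
theorem LawlerSchrammWerner2002_scalingLimitExponent_of_trace
    (htrace : ∀ ν : ProbabilityMeasure (NonemptyCompacts ℂ),
      Tendsto lswLaw atTop (𝓝 ν) → ∀ t : ℝ, 0 < t → lswHit 6 (2 * Real.pi) t =
        (ν : Measure (NonemptyCompacts ℂ)).real
          {K | Literature.Analysis.Complex.conformalRadius (K : Set ℂ) ≤ Real.exp (-t)}) :
    LawlerSchrammWerner2002_scalingLimitExponent :=
  LawlerSchrammWerner2002_scalingLimitExponent_of_hittingPDE
    (LawlerSchrammWerner2002_hittingPDE_of_trace htrace)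

/-- **LSW Theorem 1.1 from the existence of the scaling limit and the trace identification at
it**: the existence of the weak limit of `lswLaw` (`h₁`; LSW p. 3) and the hypothesis of
`LawlerSchrammWerner2002_hittingPDE_of_trace` give `oneArm_exponent`
(`oneArm_exponent_of_scalingLimit_of_hittingPDE`) — the dependency structure of the paper
("By [22, 23], the limit exists", p. 3, then §2–§3).
[cite: LawlerSchrammWernerEJP2002, Thm. 1.1 (p. 2), §2–§3] -/
theorem oneArm_exponent_of_scalingLimit_of_trace
    (h₁ : ∃ ν : ProbabilityMeasure (NonemptyCompacts ℂ), Tendsto lswLaw atTop (𝓝 ν))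
    (htrace : ∀ ν : ProbabilityMeasure (NonemptyCompacts ℂ),
      Tendsto lswLaw atTop (𝓝 ν) → ∀ t : ℝ, 0 < t → lswHit 6 (2 * Real.pi) t =
        (ν : Measure (NonemptyCompacts ℂ)).real
          {K | Literature.Analysis.Complex.conformalRadius (K : Set ℂ) ≤ Real.exp (-t)}) :
    oneArm_exponent :=
  oneArm_exponent_of_scalingLimit_of_hittingPDE h₁
    (LawlerSchrammWerner2002_hittingPDE_of_trace htrace)

end Literature.Probability.Percolation
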